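import Summits.Schanuel.Schanuel.Theorems.RootDecomp1KSubspaceBranch03

/-!
# RootDecomp1KSubspaceBranch — lens 1, generation 52, node 11 «p-ADIC SUBSPACE AT THE LIVE NEAR-ROOT BRANCH — m₀ = 2 BELOW RIDOUT'S EXPONENT» (RULE K-R40 (viii)(α)) — continuation (RootDecomp1KSubspaceBranch04): §8 intrinsic form and the residual RE-BOOKED, §9 members at m₀ = 2 and the costume test

(lens-1 g52 node 11 HOME kernel K = HOME/decomp-schanuel-lens-1/g52/SubspaceBranch.lean a7b59aa9…, 1162 l, 79 thm + 9 def, imports tree …RootDecomp1KXTop03 + …RootDecomp1KXAll05 + …RootDecomp1KLevelFinite11 + …RootDecomp1KLevelFinite13 ONLY; Probe SubspaceBranchProbe.lean 53090850… / Ctrl0 d8674a5f… / Ctrl 041869f9…; memo NODE-g52.md 489a38e4…; SHA256SUMS; cite-kind ledger item wi-102433 (PadicSubspace → statement-only Literature fact typed to Bilu, Sém. Bourbaki 967 Thm 2.3); CLAIM L2534, crit EX-ANTE PRICE L2535 (ONE THEOREM ×1 «SUBSPACE BRANCH» under RULE K-R40 (viii)(α) iff CHECKLIST K-g52; RULE K-R41),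 NODE L2542 / REQUEST L2543, writer re-check L2548, critic VERDICT L2546: CLEARED — THEOREM ×1 «SUBSPACE BRANCH» under RULE K-R40 (viii)(α), CHECKLIST K-g52 met; PORT GO L2546/L2547 (A) (four parts, docstrings, private re-emissions, scoped maxHeartbeats, «(sources: …)» binder — sanctioned ex ante); RULES K-R41 / K-R42. Port by census-1 gen 22 as `RootDecomp1KSubspaceBranch01–04` (`--supports stmt-Schanuel-33364`; no census credit): 01 = §0 the ONE new Diophantine input typed by name **`PadicSubspace : Prop`** ([hypothesis] definition — Schlickewei's p-adic Subspace Theorem over `ℚ` at `{∞, p}`, integer points, algebraic coefficients, `ε = 1/q`; sources in the docstring; a THEOREM in print, NOT proved in the tree; NOT the tree's rational-form `Subspace*` I–VI) + §1 helpers + §2 the ultrametric Taylor tail + §3 the second-order level identity and the refined approximation `‖r − β + 2^{N!}·γ_β‖₂` at a simple root; 02 = §4 algebraicity of the correction `γ_β`, the integer vector `xvec N r = (num r, den r, 2^{N!}·den r)` and the `3 + 3` linear forms `Lform` / `Mform` (linear independence, algebraicity) + §5 the exponent inequality (`ε = 1/8`, `N₀ = N₀(C, P)`); 03 = §6 subspace-by-subspace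 finiteness of levels (no Diophantine input) + §7 ASSEMBLY **`thinFibreAt_xPoly_of_padicSubspace (hS : PadicSubspace) … (hsep) (hdeg) (hm : 2 ≤ m₀) (hme : e + 1 ≤ m₀) : ThinFibreAt m₀ (xPolyP k c)`** (the tree's `RootDecomp1KXTop.thinFibreAt_xPoly` with `3 ≤ m₀` replaced by `2 ≤ m₀`; the `m₀ ≥ 3` branch delegated to the tree by name); 04 = §8 intrinsic form + the residual of record RE-BOOKED (`SiegelShapesOffSbAt`, `ThinFibre m₀ ⟸ PadicSubspace ∧ SiegelShapesOffSbAt m₀`; bookkeeping ×0 by K-R40 (vi)) + §9 members at `m₀ = 2` (`M17P` = x²(Y²−17) + x(Y³+Y+1) + (Y³−2), `L17P` = (Y+3) + x(Y²−17), the family) and the COSTUME TEST BY NAME (`¬ DecidedAt 2 M17P` disjunct by disjunct). PORT EDITS: K's module-docstring line «Imports: tree XTop03, LevelFinite13 only» corrected to the four actual imports (writer L2548; docstring-only); 20 one-line docstrings added on undocumented computation lemmas (statements quoted); the 14 `private` helpers of K stay private (file-local copies re-emitted in later parts where used); K's five `set_option maxHeartbeats … in` kept as in K; statements and proofs otherwise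 VERBATIM. Rung 0 — nothing here proves Schanuel, 33364, 33363, 31077, ThinFibre 2 or SiegelShapesOffAt 2; the headline is CONDITIONAL on `PadicSubspace`.)
-/

noncomputable section

namespace Summit.Schanuel.Schanuel.Theorems.RootDecomp1KSubspaceBranch

open Polynomial LiouvilleNumber
open scoped Nat
open Summit.Schanuel.Schanuel.Theorems.RootDecomp1KSkelCell (SkelLiouvilleFix)
open Summit.Schanuel.Schanuel.Theorems.RootDecomp1KTwoBaseCell (psNumer partialSum_eq_psNumer_div)
open Summit.Schanuel.Schanuel.Theorems.RootDecomp1KRelLiouvilleCell (partialSum_two_strictMono)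
open Summit.Schanuel.Schanuel.Theorems.RootDecomp1KDegreeLadder
open Summit.Schanuel.Schanuel.Theorems.RootDecomp1KXLinearCore
open Summit.Schanuel.Schanuel.Theorems.RootDecomp1KXLinear
open Summit.Schanuel.Schanuel.Theorems.RootDecomp1KXLinearII
open Summit.Schanuel.Schanuel.Theorems.RootDecomp1KXTop
open Summit.Schanuel.Schanuel.Theorems.RootDecomp1KXAll
open Summit.Schanuel.Schanuel.Theorems.RootDecomp1KLevelFinite

/-! ### §8  Intrinsic form; the residual of record RE-BOOKED (bookkeeping, ×0 by K-R40 (vi) — said so) -/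

/-- **INTRINSIC FORM** — the tree's threshold `thinThreshold P = max(3, 2μ+1, e+1)` (`RootDecomp1KXAll.thinFibreAt_all`)
with its `3` REPLACED BY `2` on separable tops (`μ ≤ 1`), modulo `PadicSubspace`: for every `P` whose top
`x`-coefficient `topX P` is separable over `ℚ` and every `m₀ ≥ max(2, eTop P + 1)`, `ThinFibreAt m₀ P`. -/
theorem thinFibreAt_of_sepTop (hS : PadicSubspace) (P : ℤ[X][X])
    (hsep : ((topX P).map (Int.castRingHom ℚ)).Separable) {m₀ : ℕ} (hm : 2 ≤ m₀) (he : eTop P + 1 ≤ m₀) :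
    ThinFibreAt m₀ P := by
  have hdeg : ∀ j, j < xdeg P → (xCoeff P j).natDegree ≤ (xCoeff P (xdeg P)).natDegree + eTop P := by
    intro j _
    have h1 := natDegree_xCoeff_le P j
    have h2 := natDegree_topX_le P
    show (xCoeff P j).natDegree ≤ (topX P).natDegree + (P.natDegree - (topX P).natDegree)
    omega
  have key := thinFibreAt_xPoly_of_padicSubspace hS (xdeg P) (xCoeff P) (eTop P) hsep hdeg hm he
  rwa [xPolyP_xCoeff] at key

/-- [class] definition (census convention): **the SUBSPACE CLASS at quality `m₀`** — top `x`-coefficient separable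
over `ℚ` (all finite points over `x = ∞` simple) and the point `(∞, ∞)` of order `eTop P ≤ m₀ − 1`. -/
def SepTopAt (m₀ : ℕ) (P : ℤ[X][X]) : Prop :=
  ((topX P).map (Int.castRingHom ℚ)).Separable ∧ eTop P + 1 ≤ m₀

/-- the subspace class IS decided at `m₀ ≥ 2`, modulo `PadicSubspace`. -/
theorem thinFibreAt_of_sepTopAt (hS : PadicSubspace) {m₀ : ℕ} (hm : 2 ≤ m₀) {P : ℤ[X][X]} (h : SepTopAt m₀ P) :
    ThinFibreAt m₀ P :=
  thinFibreAt_of_sepTop hS P h.1 hm h.2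

/-- [residual statement def — NOT proved; census convention] **Siegel's clause OFF everything decided at `m₀` AND OFF
the subspace class**: demanded only for primes with a NON-separable top `x`-coefficient, or with `eTop P ≥ m₀`
(and outside `DecidedAt m₀`). -/
def SiegelShapesOffSbAt (m₀ : ℕ) : Prop :=
  ∀ P : ℤ[X][X], Prime P → 2 ≤ P.natDegree → ¬ DecidedAt m₀ P → ¬ SepTopAt m₀ P → SiegelClause P

/-- the weakening, PROVED: `SiegelShapesOffAt m₀ → SiegelShapesOffSbAt m₀`. -/
theorem siegelShapesOffSbAt_of_offAt {m₀ : ℕ} (h : SiegelShapesOffAt m₀) : SiegelShapesOffSbAt m₀ :=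
  fun P hP hd hnd _ => h P hP hd hnd

/-- … hence from `SiegelShapesOff` / `SiegelShapes` (tree chain). -/
theorem siegelShapesOffSbAt_of_off (h : SiegelShapesOff) {m₀ : ℕ} (hm : 2 ≤ m₀) : SiegelShapesOffSbAt m₀ :=
  siegelShapesOffSbAt_of_offAt (siegelShapesOffAt_of_off h hm)

/-- **THE RESIDUAL RE-BOOKED**: `ThinFibre m₀ ⟸ PadicSubspace ∧ SiegelShapesOffSbAt m₀` (`m₀ ≥ 2`) — the residual of
record `SiegelShapesOffAt m₀` is replaced by the print fact `PadicSubspace` plus Siegel's clause on the SMALLER class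
(non-separable top, or `eTop ≥ m₀`).  Bookkeeping; no ∀-item moves. -/
theorem thinFibre_of_padicSubspace_offSbAt {m₀ : ℕ} (hm : 2 ≤ m₀) (hS : PadicSubspace)
    (hSb : SiegelShapesOffSbAt m₀) : ThinFibre m₀ := by
  refine thinFibre_of_prime hm fun P hP hd => ?_
  by_cases h : DecidedAt m₀ P
  · exact thinFibreAt_of_decidedAt hm hP.ne_zero h
  · by_cases h' : SepTopAt m₀ P
    · exact thinFibreAt_of_sepTopAt hS hm h'
    · exact thinFibreAt_of_levelFinite (levelFinite_of_siegelClause (hSb P hP hd h h')) m₀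

/-- … and the (b)-cell from it. -/
theorem b_of_padicSubspace_offSbAt {m₀ : ℕ} (hm : 2 ≤ m₀) (hS : PadicSubspace) (hSb : SiegelShapesOffSbAt m₀)
    (ρ : ℝ) (hρ : SkelLiouvilleFix m₀ ρ) : AlgebraicIndependent ℚ ![((liouvilleNumber 2 : ℝ) : ℂ), (ρ : ℂ)] :=
  thinFibre_imp_b (by omega) (thinFibre_of_padicSubspace_offSbAt hm hS hSb) ρ hρ

/-! ### §9  Members at `m₀ = 2` and the costume test BY NAME -/

/-- x-LINEAR CASE II AT `m₀ = 2` (new): `A(Y) + x·B(Y)` with `B` separable over `ℚ` and `deg A ≤ deg B + 1`,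
every `m₀ ≥ 2` (tree `thinFibreAt_xLinear_of_sep`: `m₀ ≥ 3`). -/
theorem thinFibreAt_xLinear_of_padicSubspace (hS : PadicSubspace) (A B : ℤ[X])
    (hsep : (B.map (Int.castRingHom ℚ)).Separable) (hle : A.natDegree ≤ B.natDegree + 1) {m₀ : ℕ} (hm : 2 ≤ m₀) :
    ThinFibreAt m₀ (xLinP A B) := by
  have h := thinFibreAt_xPoly_of_padicSubspace hS 1 (fun j => if j = 0 then A else B) 1 (by simpa using hsep)
    (fun j hj => by
      have : j = 0 := by omega
      subst this; simpa using hle) hm (by omega)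
  rwa [xPolyP_one] at h

/-- THE FAMILY of every `x`-degree `k` and `Y`-degree `d ≥ 1`, `Σ_{j ≤ k} x^j (Y^d − (j + 2))`, now at every `m₀ ≥ 2`
(tree `thinFibreAt_family`: `m₀ ≥ 3`). -/
theorem thinFibreAt_family_of_padicSubspace (hS : PadicSubspace) (k d : ℕ) (hd : 1 ≤ d) {m₀ : ℕ} (hm : 2 ≤ m₀) :
    ThinFibreAt m₀ (xPolyP k fun j => X ^ d - Polynomial.C ((j : ℤ) + 2)) := by
  refine thinFibreAt_xPoly_of_padicSubspace hS k _ 0 ?_ (fun j _ => ?_) hm (by omega)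
  · rw [Polynomial.map_sub, Polynomial.map_pow, Polynomial.map_X, Polynomial.map_C]
    refine separable_X_pow_sub_C _ (by norm_num [Nat.cast_eq_zero]; omega) ?_
    simp only [eq_intCast, Int.cast_add, Int.cast_natCast, Int.cast_ofNat, ne_eq]
    norm_cast
  · rw [natDegree_X_pow_sub_C, natDegree_X_pow_sub_C]; rfl

/-- the `x`-coefficients of the showcase member `M17P = x²(Y² − 17) + x(Y³ + Y + 1) + (Y³ − 2)`. -/
def m17C : ℕ → ℤ[X] := fun j =>
  if j = 2 then X ^ 2 - Polynomial.C 17 else if j = 1 then X ^ 3 + X + 1 else X ^ 3 - Polynomial.C 2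

/-- **THE SHOWCASE MEMBER** `M17P = x²·(Y² − 17) + x·(Y³ + Y + 1) + (Y³ − 2)`: `x`-degree `2`, `Y`-degree `3`, top
`x`-coefficient `Y² − 17` separable with the two SIMPLE roots `±√17 ∈ ℤ₂` (`17 ≡ 1 mod 8`), `e = 1`. -/
def M17P : ℤ[X][X] := xPolyP 2 m17C

/-- `m17C 2 = X ^ 2 - Polynomial.C 17`. -/
theorem m17C_two : m17C 2 = X ^ 2 - Polynomial.C 17 := by simp [m17C]
/-- `m17C 1 = X ^ 3 + X + 1`. -/
theorem m17C_one : m17C 1 = X ^ 3 + X + 1 := by simp [m17C]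
/-- `m17C 0 = X ^ 3 - Polynomial.C 2`. -/
theorem m17C_zero : m17C 0 = X ^ 3 - Polynomial.C 2 := by simp [m17C]

/-- `(m17C 2).natDegree = 2`. -/
theorem natDegree_m17C_two : (m17C 2).natDegree = 2 := by rw [m17C_two]; compute_degree!
/-- `(m17C 1).natDegree = 3`. -/
theorem natDegree_m17C_one : (m17C 1).natDegree = 3 := by rw [m17C_one]; compute_degree!
/-- `(m17C 0).natDegree = 3`. -/
theorem natDegree_m17C_zero : (m17C 0).natDegree = 3 := by rw [m17C_zero]; compute_degree!

/-- the top `Y² − 17` is separable over `ℚ`. -/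
theorem separable_m17C_two : ((m17C 2).map (Int.castRingHom ℚ)).Separable := by
  rw [m17C_two, Polynomial.map_sub, Polynomial.map_pow, Polynomial.map_X, Polynomial.map_C]
  exact separable_X_pow_sub_C _ (by norm_num) (by norm_num)

/-- `deg c_j ≤ deg c_2 + 1`: the point `(∞, ∞)` has order `e = 1`. -/
theorem m17C_deg : ∀ j, j < 2 → (m17C j).natDegree ≤ (m17C 2).natDegree + 1 := by
  intro j hj
  rw [natDegree_m17C_two]
  interval_cases j
  · rw [natDegree_m17C_zero]
  · rw [natDegree_m17C_one]

/-- `bev M17P x y = (y³ − 2) + x(y³ + y + 1) + x²(y² − 17)`. -/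
theorem bev_M17P (x y : ℝ) : bev M17P x y = (y ^ 3 - 2) + x * (y ^ 3 + y + 1) + x ^ 2 * (y ^ 2 - 17) := by
  rw [M17P, bev_xPolyP]
  simp [Finset.sum_range_succ, m17C_zero, m17C_one, m17C_two, map_ofNat]

/-- **`ThinFibreAt 2 M17P` — modulo `PadicSubspace`** (and every `m₀ ≥ 2`). -/
theorem thinFibreAt_M17P (hS : PadicSubspace) {m₀ : ℕ} (hm : 2 ≤ m₀) : ThinFibreAt m₀ M17P :=
  thinFibreAt_xPoly_of_padicSubspace hS 2 m17C 1 separable_m17C_two m17C_deg hm (by omega)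

/-- the x-linear case-II member `L17P = (Y + 3) + x·(Y² − 17)` at `m₀ = 2`. -/
def L17P : ℤ[X][X] := xLinP (X + Polynomial.C 3) (X ^ 2 - Polynomial.C 17)

/-- `(hS : PadicSubspace) {m₀ : ℕ} (hm : 2 ≤ m₀) : ThinFibreAt m₀ L17P` — the x-linear case-II member `(Y+3) + x(Y²−17)` at every `m₀ ≥ 2`, modulo `PadicSubspace`. -/
theorem thinFibreAt_L17P (hS : PadicSubspace) {m₀ : ℕ} (hm : 2 ≤ m₀) : ThinFibreAt m₀ L17P := by
  refine thinFibreAt_xLinear_of_padicSubspace hS _ _ ?_ ?_ hm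
  · rw [Polynomial.map_sub, Polynomial.map_pow, Polynomial.map_X, Polynomial.map_C]
    exact separable_X_pow_sub_C _ (by norm_num) (by norm_num)
  · have h1 : (X + Polynomial.C 3 : ℤ[X]).natDegree = 1 := by compute_degree!
    have h2 : (X ^ 2 - Polynomial.C 17 : ℤ[X]).natDegree = 2 := by compute_degree!
    rw [h1, h2]; norm_num

/-! #### The costume test: `M17P` lies in NO class decided at `m₀ = 2` in the tree -/

/-- `deg_Y M17P ≥ 3`: the free regime `thinFibreAt_of_natDegree_lt` (`deg_Y < m₀`) does not reach `m₀ = 2`. -/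
theorem three_le_natDegree_M17P : 3 ≤ M17P.natDegree := by
  refine le_natDegree_of_ne_zero fun h => ?_
  have h1 := congrArg (fun q : ℤ[X] => q.coeff 1) h
  simp only [M17P, coeff_coeff_xPolyP, coeff_zero] at h1
  rw [if_pos (by simp), m17C_one] at h1
  simp [coeff_X, coeff_one] at h1

/-- `¬ M17P.natDegree < 2` (costume test: the degree-ladder disjunct of `DecidedAt 2` fails). -/
theorem not_natDegree_M17P_lt_two : ¬ M17P.natDegree < 2 := by
  have := three_le_natDegree_M17P; omega

/-- `M17P` has NO x-linear presentation (`x`-degree `2`): neither `XLinearLt` nor the separable x-linear class. -/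
theorem M17P_ne_xLinP (A B : ℤ[X]) : M17P ≠ xLinP A B := by
  intro hP
  have h := fun x : ℝ => congrArg (fun Q => bev Q x 0) hP
  simp only [bev_M17P, bev_xLinP] at h
  have h0 := h 0
  have h1 := h 1
  have h2 := h 2
  norm_num at h0 h1 h2
  linarith

/-- `¬ XLinearLt M17P` (costume test: `x`-degree `2`, no x-linear presentation). -/
theorem not_xLinearLt_M17P : ¬ XLinearLt M17P := fun ⟨A, B, _, _, hP⟩ => M17P_ne_xLinP A B hP

/-- `¬ (3 ≤ 2 ∧ ∃ A B : ℤ[X], (B.map (Int.castRingHom ℚ)).Separable ∧ M17P = xLinP A B)` (costume test: the separable x-linear disjunct of `DecidedAt 2` fails already at `3 ≤ 2`). -/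
theorem not_xLinear_sep_M17P : ¬ (3 ≤ 2 ∧ ∃ A B : ℤ[X], (B.map (Int.castRingHom ℚ)).Separable ∧ M17P = xLinP A B) :=
  fun h => by omega

/-- the tree's threshold is `≥ 3 > 2` (for any curve). -/
theorem not_thinThreshold_M17P_le_two : ¬ thinThreshold M17P ≤ 2 := by
  have := three_le_thinThreshold M17P; omega

/-- `√17 ∈ ℤ₂` (Hensel at `a = 1`: `‖1 − 17‖₂ = 2^{−4} < ‖2‖₂² = 2^{−2}`): the top `Y² − 17` HAS a root in `ℚ₂`. -/
theorem exists_padic_root_m17C_two : ∃ z : ℚ_[2], aeval z (m17C 2) = 0 := by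
  rw [m17C_two]
  have h2 : ‖(2 : ℤ_[2])‖ = 1 / 2 := by
    have := PadicInt.norm_p (p := 2); simpa using this
  have hF : ‖aeval (1 : ℤ_[2]) (X ^ 2 - Polynomial.C (17 : ℤ) : ℤ[X])‖ <
      ‖aeval (1 : ℤ_[2]) (derivative (X ^ 2 - Polynomial.C (17 : ℤ) : ℤ[X]))‖ ^ 2 := by
    have e1 : aeval (1 : ℤ_[2]) (X ^ 2 - Polynomial.C (17 : ℤ) : ℤ[X]) = -(2 ^ 4) := by
      simp [map_ofNat]; norm_num
    have e2 : aeval (1 : ℤ_[2]) (derivative (X ^ 2 - Polynomial.C (17 : ℤ) : ℤ[X])) = 2 := by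
      simp [map_ofNat]
    rw [e1, e2, norm_neg, norm_pow, h2]; norm_num
  obtain ⟨z, hz, -⟩ := hensels_lemma hF
  refine ⟨(z : ℚ_[2]), ?_⟩
  have := Polynomial.aeval_algebraMap_apply ℚ_[2] z (X ^ 2 - Polynomial.C (17 : ℤ) : ℤ[X])
  rw [hz, map_zero] at this
  simpa using this

/-- in EVERY presentation `M17P = Σ_{j ≤ k} x^j c_j(Y)` the top `x`-coefficient has a root in `ℚ₂` (it is `Y² − 17`
or `0`): `M17P ∉ RootlessTop e` for any `e` — the near-root branch is LIVE. -/
theorem exists_padic_root_top_of_M17P_eq (k : ℕ) (c : ℕ → ℤ[X]) (h : M17P = xPolyP k c) :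
    ∃ z : ℚ_[2], aeval z (c k) = 0 := by
  have hc : ∀ i j : ℕ, (if j ∈ Finset.range 3 then (m17C j).coeff i else 0) =
      (if j ∈ Finset.range (k + 1) then (c j).coeff i else 0) := by
    intro i j
    rw [← coeff_coeff_xPolyP, ← coeff_coeff_xPolyP, ← h]; rfl
  rcases lt_trichotomy k 2 with hk | rfl | hk
  · exfalso
    have h22 := hc 2 2
    rw [if_pos (by simp), if_neg (by simp; omega), m17C_two] at h22
    simp at h22
  · have hc2 : c 2 = m17C 2 := by
      ext i
      have := hc i 2
      rw [if_pos (by simp), if_pos (by simp)] at this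
      exact this.symm
    rw [hc2]
    exact exists_padic_root_m17C_two
  · refine ⟨0, ?_⟩
    have hck : c k = 0 := by
      ext i
      have := hc i k
      rw [if_neg (by simp; omega), if_pos (by simp)] at this
      rw [coeff_zero]; exact this.symm
    rw [hck, map_zero]

/-- `(e : ℕ) : ¬ RootlessTop e M17P` (costume test: the top `Y² − 17` HAS a root in `ℚ₂`). -/
theorem not_rootlessTop_M17P (e : ℕ) : ¬ RootlessTop e M17P := by
  rintro ⟨k, c, _, hroot, hP⟩
  obtain ⟨z, hz⟩ := exists_padic_root_top_of_M17P_eq k c hP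
  exact hroot z hz

/-- **`M17P` is in NO class decided at `m₀ = 2`** (each disjunct of `DecidedAt 2` refuted by name). -/
theorem not_decidedAt_two_M17P : ¬ DecidedAt 2 M17P := by
  rintro (h | h | h | h | h)
  · exact not_natDegree_M17P_lt_two h
  · exact not_xLinearLt_M17P h
  · exact not_xLinear_sep_M17P h
  · exact not_thinThreshold_M17P_le_two h
  · exact not_rootlessTop_M17P 1 h

/-- … but it IS in the subspace class at `m₀ = 2`. -/
theorem sepTopAt_two_M17P : SepTopAt 2 M17P := by
  have htop : topX M17P = m17C 2 := topX_xPolyP 2 m17C (by rw [m17C_two]; exact X_pow_sub_C_ne_zero (by norm_num) _)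
  refine ⟨by rw [htop]; exact separable_m17C_two, ?_⟩
  have he := eTop_xPolyP_le 2 m17C 1 (by rw [m17C_two]; exact X_pow_sub_C_ne_zero (by norm_num) _) m17C_deg
  show eTop M17P + 1 ≤ 2
  unfold M17P; omega

/-- the x-LACUNARY DEGREE LADDER (`thinFibreAt_xPolyP_gap`, addendum 4) does not apply to `M17P`: with gap `γ = 1`
it needs `deg_Y < 1·2`, and the gap `γ = 2` needs `c_1 = 0`. -/
theorem m17C_one_ne_zero : m17C 1 ≠ 0 := by
  rw [m17C_one]; intro h
  have := congrArg (fun q : ℤ[X] => q.coeff 0) h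
  simp at this

/-- `M17P` is NOT a two-term curve `x^k·B(Y) − A(Y)` (`thinFibreAt_twoTermP` does not apply). -/
theorem M17P_ne_twoTermP (k : ℕ) (B A : ℤ[X]) : M17P ≠ twoTermP k B A := by
  intro h
  have hc : ∀ i j : ℕ, (if j ∈ Finset.range 3 then (m17C j).coeff i else 0) =
      ((if j = k then B.coeff i else 0) - (if j = 0 then A.coeff i else 0)) := by
    intro i j
    rw [← coeff_coeff_xPolyP, ← coeff_coeff_twoTermP, ← h]; rfl
  by_cases hk : k = 1
  · subst hk
    have h22 := hc 2 2
    rw [if_pos (by simp), if_neg (by norm_num), if_neg (by norm_num), m17C_two] at h22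
    simp at h22
  · have h31 := hc 3 1
    rw [if_pos (by simp), if_neg (fun h => hk h.symm), if_neg (by norm_num), m17C_one] at h31
    simp [coeff_X, coeff_one] at h31

end Summit.Schanuel.Schanuel.Theorems.RootDecomp1KSubspaceBranch

end
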